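import Literature.AlgebraicTopology.SingularHomology.FiniteDeckTransfer
import Literature.AlgebraicTopology.SingularHomology.CohomologyRingChange
import Mathlib.LinearAlgebra.Dimension.Finrank
import HarnessLib

/-!
# Change of coefficients in singular cohomology: functoriality, transfer, conjugation of endomorphisms

Elementary complements to the tree's change of coefficient ring in singular cohomology,
`singularCohomology.ringChange f Y n : Hⁿ(Y; R) →+ Hⁿ(Y; S)`, `[u] ↦ [f ∘ u]`
(`Literature.AlgebraicTopology.SingularHomology.CohomologyRingChange`; Hatcher, *Algebraic
Topology* (2002), §3.1 p. 198 "change of coefficients"), all PROVED on representing cocycles: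

* functoriality `ringChange_comp_apply` (`(g ∘ f)_* = g_* ∘ f_*`), `ringChange_id_apply`, and
  `f`-semilinearity `ringChange_smul` (`f_*(c • x) = f(c) • f_* x`);
* `ringChange_transferMap`: **change of coefficients commutes with the transfer** `τ^*` of a finite
  regular covering (`FiniteDeckTransfer`; Hatcher §3.G p. 321: `(τψ)(σ) = Σ_g ψ(g ∘ σ̃)` is a finite
  sum of values, and `f(Σ …) = Σ f(…)`), with the cocycle-level description `transferMap_π`;
* for a ring AUTOMORPHISM `σ : R ≃+* R`: `σ_*` is bijective with inverse `σ⁻¹_*`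
  (`ringChange_symm_apply`, `ringChange_apply_symm`), and the induced **conjugation of
  endomorphisms** `conjEnd σ a = σ_* ∘ a ∘ σ⁻¹_*` of `Hⁿ(Y; R)` is `R`-linear, multiplicative,
  unital, additive, `σ`-semilinear in `a`, involutive up to `σ ↔ σ⁻¹`, and preserves the dimension
  of the image of any `σ_*`-stable submodule (`finrank_map_conjEnd`, through Mathlib's
  `rank_eq_of_equiv_equiv`: a `σ`-semilinear additive bijection preserves `Module.rank`).

Written for the coefficient-conjugation sieve of crux `EndoscopicMiddleDegree.MiddleThetaSpan`
(stmt-HodgeConjecture-13661, line `conjugate-dimension-sieve`, stub `stub_sieve`), where `σ ∈ Aut(ℂ)`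
acts on `Hᵏ(X(ℂ); ℚ) ⊗ ℂ` through the coefficients and conjugates the Hecke-isotypic projectors; kept
free of that context (pure singular cohomology). Not here: the fixing of rational classes over `ℂ`
(one line from `RationalClassesRingChange.isRationalClass_iff_exists_ringChange`, stated by the consumer).

## References

* [HatcherAT2002] A. Hatcher, *Algebraic Topology*, CUP 2002, §3.1 p. 198 (change of
  coefficients), §3.G p. 321 (transfer).
-/

noncomputable section

namespace Literature.AlgebraicTopology.SingularHomology

open CategoryTheory
open Literature.AlgebraicTopology.SingularHomology.singularCochainComplex

universe u v w

section RingChangeToolkit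

variable {R S T : Type v} [CommRing R] [CommRing S] [CommRing T]
variable {Y : Type u} [TopologicalSpace Y] {n : ℕ}

/-! ### Functoriality and semilinearity of the change of coefficients -/

/-- **Functoriality of the change of coefficients**: `(g ∘ f)_* = g_* ∘ f_*` on `Hⁿ(Y; ·)`
(both sides send `[u]` to `[g ∘ f ∘ u]`; Hatcher 2002, §3.1 p. 198).
[cite: HatcherAT2002, §3.1 p. 198] -/
theorem ringChange_comp_apply (f : R →+* S) (g : S →+* T) (x : singularCohomology R R Y n) :
    singularCohomology.ringChange (g.comp f) Y n x =
      singularCohomology.ringChange g Y n (singularCohomology.ringChange f Y n x) := by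
  induction x using singularCohomology_induction_on with
  | h u =>
    rw [singularCohomology.ringChange_π, singularCohomology.ringChange_π,
      singularCohomology.ringChange_π]
    congr 1
    refine coFn_injective ?_
    rw [coFn_cocyclesRingChange, coFn_cocyclesRingChange, coFn_cocyclesRingChange]
    rfl

/-- `(id_R)_* = id` on `Hⁿ(Y; R)`. [cite: HatcherAT2002, §3.1 p. 198] -/
theorem ringChange_id_apply (x : singularCohomology R R Y n) :
    singularCohomology.ringChange (RingHom.id R) Y n x = x := by
  induction x using singularCohomology_induction_on with
  | h u =>
    rw [singularCohomology.ringChange_π]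
    congr 1
    refine coFn_injective ?_
    rw [coFn_cocyclesRingChange]
    rfl

/-- **The change of coefficients is `f`-semilinear**: `f_*(c • x) = f(c) • f_* x` (on cocycles
`f ∘ (c u) = f(c) (f ∘ u)`). [cite: HatcherAT2002, §3.1 p. 198] -/
theorem ringChange_smul (f : R →+* S) (c : R) (x : singularCohomology R R Y n) :
    singularCohomology.ringChange f Y n (c • x) = f c • singularCohomology.ringChange f Y n x := by
  induction x using singularCohomology_induction_on with
  | h u =>
    rw [← map_smul, singularCohomology.ringChange_π, singularCohomology.ringChange_π, ← map_smul]
    congr 1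
    refine coFn_injective ?_
    have h1 : coFn (c • u) = c • coFn u := (iCocycles R R Y n).hom.map_smul c u
    have h2 : coFn (f c • cocyclesRingChange f n u) = f c • coFn (cocyclesRingChange f n u) :=
      (iCocycles S S Y n).hom.map_smul (f c) _
    rw [coFn_cocyclesRingChange, h1, h2, coFn_cocyclesRingChange]
    funext σ
    simp only [Function.comp_apply, Pi.smul_apply, smul_eq_mul, map_mul]

/-! ### Change of coefficients commutes with the transfer of a finite regular covering -/

variable {G : Type w} [Group G] [Fintype G] {E B : Type u} [TopologicalSpace E]
  [TopologicalSpace B] [MulAction G E]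

/-- The transfer in cohomology is computed on representing cocycles: `τ^*[u] = [τ u]`.
[cite: HatcherAT2002, §3.G p. 321] -/
theorem transferMap_π (c : FiniteDeckCover G E B) (u : cocycles R R E n) :
    c.transferMap (R := R) n (singularCohomology.π R R E n u) =
      singularCohomology.π R R B n (HomologicalComplex.cyclesMap c.transfer n u) := by
  change ((singularCochainComplex R R E).homologyπ n ≫
      HomologicalComplex.homologyMap c.transfer n) u =
    (HomologicalComplex.cyclesMap c.transfer n ≫ (singularCochainComplex R R B).homologyπ n) u
  rw [HomologicalComplex.homologyπ_naturality]

/-- The cochain of the transferred cocycle is the transfer of the cochain.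
[cite: HatcherAT2002, §3.G p. 321] -/
theorem coFn_cyclesMap_transfer (c : FiniteDeckCover G E B) (u : cocycles R R E n) :
    coFn (HomologicalComplex.cyclesMap (c.transfer (R := R)) n u) = c.transfer.f n (coFn u) := by
  change (HomologicalComplex.cyclesMap c.transfer n ≫ iCocycles R R B n) u =
    (iCocycles R R E n ≫ c.transfer.f n) u
  rw [HomologicalComplex.cyclesMap_i]

/-- On cochains the transfer commutes with post-composition by a ring homomorphism:
`f ∘ (τψ) = τ(f ∘ ψ)` (`(τψ)(σ) = Σ_g ψ(g ∘ σ̃)` is a finite sum of values).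
[cite: HatcherAT2002, §3.G p. 321] -/
theorem comp_transfer_f (c : FiniteDeckCover G E B) (f : R →+* S)
    (ψ : SingularSimplex E n → R) :
    (f ∘ (c.transfer (R := R)).f n ψ : SingularSimplex B n → S) =
      (c.transfer (R := S)).f n (f ∘ ψ) := by
  funext σ
  rw [Function.comp_apply, FiniteDeckCover.transfer_f_apply, FiniteDeckCover.transfer_f_apply,
    FiniteDeckCover.orbitSum, FiniteDeckCover.orbitSum, map_sum]
  rfl

/-- **Change of coefficients commutes with the transfer**: `f_*(τ^* x) = τ^*(f_* x)` for a finite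
regular covering `E → B` and a ring homomorphism `f : R → S` (one acts on the simplices, the other
on the values of cochains). [cite: HatcherAT2002, §3.G p. 321] -/
theorem ringChange_transferMap (c : FiniteDeckCover G E B) (f : R →+* S)
    (x : singularCohomology R R E n) :
    singularCohomology.ringChange f B n (c.transferMap n x) =
      c.transferMap n (singularCohomology.ringChange f E n x) := by
  induction x using singularCohomology_induction_on with
  | h u =>
    rw [transferMap_π, singularCohomology.ringChange_π, singularCohomology.ringChange_π,
      transferMap_π]
    congr 1
    refine coFn_injective ?_
    rw [coFn_cocyclesRingChange, coFn_cyclesMap_transfer, coFn_cyclesMap_transfer,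
      coFn_cocyclesRingChange, comp_transfer_f]

/-! ### Ring automorphisms: `σ_*` is a `σ`-semilinear bijection -/

variable (σ : R ≃+* R)

/-- `σ_* (σ⁻¹_* x) = x`. [cite: HatcherAT2002, §3.1 p. 198] -/
theorem ringChange_symm_apply (x : singularCohomology R R Y n) :
    singularCohomology.ringChange (σ : R →+* R) Y n
      (singularCohomology.ringChange (σ.symm : R →+* R) Y n x) = x := by
  rw [← ringChange_comp_apply,
    show (σ : R →+* R).comp (σ.symm : R →+* R) = RingHom.id R from
      RingHom.ext fun r => σ.apply_symm_apply r,
    ringChange_id_apply]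

/-- `σ⁻¹_* (σ_* x) = x`. [cite: HatcherAT2002, §3.1 p. 198] -/
theorem ringChange_apply_symm (x : singularCohomology R R Y n) :
    singularCohomology.ringChange (σ.symm : R →+* R) Y n
      (singularCohomology.ringChange (σ : R →+* R) Y n x) = x := by
  rw [← ringChange_comp_apply,
    show (σ.symm : R →+* R).comp (σ : R →+* R) = RingHom.id R from
      RingHom.ext fun r => σ.symm_apply_apply r,
    ringChange_id_apply]

/-- `σ_*` is injective for a ring automorphism `σ`. [cite: HatcherAT2002, §3.1 p. 198] -/
theorem ringChange_equiv_injective :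
    Function.Injective (singularCohomology.ringChange (σ : R →+* R) Y n) :=
  Function.LeftInverse.injective (g := singularCohomology.ringChange (σ.symm : R →+* R) Y n)
    (ringChange_apply_symm σ)

/-- `σ_*(c • x) = σ(c) • σ_* x`. [cite: HatcherAT2002, §3.1 p. 198] -/
theorem ringChange_equiv_smul (c : R) (x : singularCohomology R R Y n) :
    singularCohomology.ringChange (σ : R →+* R) Y n (c • x) =
      σ c • singularCohomology.ringChange (σ : R →+* R) Y n x :=
  ringChange_smul (σ : R →+* R) c x

/-! ### Conjugation of endomorphisms of `Hⁿ(Y; R)` by `σ_*` -/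

/-- **Conjugation of an endomorphism by the coefficient automorphism**:
`conjEnd σ a = σ_* ∘ a ∘ σ⁻¹_*`, an `R`-LINEAR endomorphism of `Hⁿ(Y; R)` (`σ_*` and `σ⁻¹_*` are
semilinear over mutually inverse automorphisms). For `Hⁿ(Y; R) = Hⁿ(Y; ℚ) ⊗ R` and `a = b ⊗ 1`
defined over `ℚ` this is `a` again; in general it is "`a` with conjugated matrix coefficients".
[cite: HatcherAT2002, §3.1 p. 198] -/
def conjEnd (a : Module.End R (singularCohomology R R Y n)) :
    Module.End R (singularCohomology R R Y n) where
  toFun x := singularCohomology.ringChange (σ : R →+* R) Y n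
    (a (singularCohomology.ringChange (σ.symm : R →+* R) Y n x))
  map_add' x y := by rw [map_add, map_add, map_add]
  map_smul' c x := by
    rw [RingHom.id_apply, ringChange_equiv_smul, map_smul, ringChange_equiv_smul,
      RingEquiv.apply_symm_apply]

/-- Unfolding `conjEnd`. [folklore] -/
theorem conjEnd_apply (a : Module.End R (singularCohomology R R Y n))
    (x : singularCohomology R R Y n) :
    conjEnd σ a x = singularCohomology.ringChange (σ : R →+* R) Y n
      (a (singularCohomology.ringChange (σ.symm : R →+* R) Y n x)) := rfl

/-- The defining intertwining relation `(conjEnd σ a) (σ_* x) = σ_* (a x)`. [folklore] -/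
theorem conjEnd_apply_ringChange (a : Module.End R (singularCohomology R R Y n))
    (x : singularCohomology R R Y n) :
    conjEnd σ a (singularCohomology.ringChange (σ : R →+* R) Y n x) =
      singularCohomology.ringChange (σ : R →+* R) Y n (a x) := by
  rw [conjEnd_apply, ringChange_apply_symm]

/-- Conjugation is multiplicative. [folklore] -/
theorem conjEnd_mul (a b : Module.End R (singularCohomology R R Y n)) :
    conjEnd σ (a * b) = conjEnd σ a * conjEnd σ b := by
  refine LinearMap.ext fun x => ?_
  rw [Module.End.mul_apply, conjEnd_apply, conjEnd_apply, conjEnd_apply, Module.End.mul_apply,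
    ringChange_apply_symm]

/-- Conjugation is unital. [folklore] -/
theorem conjEnd_one : conjEnd σ (1 : Module.End R (singularCohomology R R Y n)) = 1 := by
  refine LinearMap.ext fun x => ?_
  rw [conjEnd_apply, Module.End.one_apply, Module.End.one_apply, ringChange_symm_apply]

/-- Conjugation of `0`. [folklore] -/
theorem conjEnd_zero : conjEnd σ (0 : Module.End R (singularCohomology R R Y n)) = 0 := by
  refine LinearMap.ext fun x => ?_
  rw [conjEnd_apply, LinearMap.zero_apply, LinearMap.zero_apply, map_zero]

/-- Conjugation is additive. [folklore] -/
theorem conjEnd_add (a b : Module.End R (singularCohomology R R Y n)) :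
    conjEnd σ (a + b) = conjEnd σ a + conjEnd σ b := by
  refine LinearMap.ext fun x => ?_
  rw [conjEnd_apply, LinearMap.add_apply, LinearMap.add_apply, map_add, conjEnd_apply,
    conjEnd_apply]

/-- Conjugation on scalars: `conjEnd σ (r • 1) = σ(r) • 1`. [folklore] -/
theorem conjEnd_algebraMap (r : R) :
    conjEnd σ (algebraMap R (Module.End R (singularCohomology R R Y n)) r) =
      algebraMap R (Module.End R (singularCohomology R R Y n)) (σ r) := by
  refine LinearMap.ext fun x => ?_
  rw [conjEnd_apply, Module.algebraMap_end_apply, Module.algebraMap_end_apply,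
    ringChange_equiv_smul, ringChange_symm_apply]

/-- `conjEnd σ⁻¹ (conjEnd σ a) = a`. [folklore] -/
theorem conjEnd_symm_conjEnd (a : Module.End R (singularCohomology R R Y n)) :
    conjEnd σ.symm (conjEnd σ a) = a := by
  refine LinearMap.ext fun x => ?_
  rw [conjEnd_apply, conjEnd_apply, RingEquiv.symm_symm, ringChange_apply_symm,
    ringChange_apply_symm]

/-- `conjEnd σ (conjEnd σ⁻¹ a) = a`. [folklore] -/
theorem conjEnd_conjEnd_symm (a : Module.End R (singularCohomology R R Y n)) :
    conjEnd σ (conjEnd σ.symm a) = a := by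
  simpa only [RingEquiv.symm_symm] using conjEnd_symm_conjEnd σ.symm a

/-- **Conjugate endomorphisms have images of equal dimension on a `σ_*`-stable submodule**: if
`P ⊆ Hⁿ(Y; R)` is stable under `σ_*` and `σ⁻¹_*`, then `σ_*` restricts to a `σ`-semilinear additive
bijection `a(P) ≃ (conjEnd σ a)(P)`, and semilinear bijections over a ring automorphism preserve
`Module.rank` (Mathlib `rank_eq_of_equiv_equiv`), hence `finrank`. [folklore] -/
theorem finrank_map_conjEnd (P : Submodule R (singularCohomology R R Y n))
    (hP : ∀ x ∈ P, singularCohomology.ringChange (σ : R →+* R) Y n x ∈ P)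
    (hP' : ∀ x ∈ P, singularCohomology.ringChange (σ.symm : R →+* R) Y n x ∈ P)
    (a : Module.End R (singularCohomology R R Y n)) :
    Module.finrank R ↥(P.map a) = Module.finrank R ↥(P.map (conjEnd σ a)) := by
  have h1 : ∀ x ∈ P.map a,
      singularCohomology.ringChange (σ : R →+* R) Y n x ∈ P.map (conjEnd σ a) := by
    rintro _ ⟨p, hp, rfl⟩
    exact ⟨_, hP p hp, conjEnd_apply_ringChange σ a p⟩
  have h2 : ∀ y ∈ P.map (conjEnd σ a),
      singularCohomology.ringChange (σ.symm : R →+* R) Y n y ∈ P.map a := by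
    rintro _ ⟨q, hq, rfl⟩
    exact ⟨_, hP' q hq, by rw [conjEnd_apply, ringChange_apply_symm]⟩
  let j : ↥(P.map a) ≃+ ↥(P.map (conjEnd σ a)) :=
    { toFun := fun x => ⟨_, h1 x x.2⟩
      invFun := fun y => ⟨_, h2 y y.2⟩
      left_inv := fun x => Subtype.ext (ringChange_apply_symm σ (x : singularCohomology R R Y n))
      right_inv := fun y => Subtype.ext (ringChange_symm_apply σ (y : singularCohomology R R Y n))
      map_add' := fun x y => Subtype.ext (map_add _ _ _) }
  have hj : ∀ (r : R) (x : ↥(P.map a)), j (r • x) = σ r • j x :=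
    fun r x => Subtype.ext (ringChange_equiv_smul σ r (x : singularCohomology R R Y n))
  unfold Module.finrank
  rw [rank_eq_of_equiv_equiv σ j σ.bijective hj]

end RingChangeToolkit

end Literature.AlgebraicTopology.SingularHomology

end
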